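/- Copyright: the b2b-balaban cell (near-miss cell 7), T⁴-continuum fan-out, lineage t4-ne7b-p1 (node U5c COUNT
member).  Released under the licence of the surrounding project. -/
import Summits.QuantumFields.BalabanUV.T4Continuum.Support.HistoryGenealogyDissolveOrder

/-!
# DISSOLVING THE FRESH CLUSTERS (junction M4, pass V, part 2b — the splice order): the new regions standing in for a
continued fresh cluster are enumerated LEAF-FIRST ending at a region that touches what comes after the cluster in
print's list, so the leaf-first touch clause (G-touch), the join clause (G-join) and the cover condition SURVIVE the
splice (owner module of row NE7b, lineage `t4-ne7b-p1` gen 42; ruling R-OWNER-42-1 «pass V supersedes pass T» =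
R-OWNER-22-7 (α) at the junction; re-open object (α), `SCOPE-alpha.md` v2.3 §5 row M4, located open point G-M4-1 —
PRE-POSITIONING ONLY)

Summits-side support leaf of the T⁴-continuum cell (rung (B)+1 on a FINITE torus only; NOT infinite volume, NOT the
mass gap, NOT the Clay statement; NOT a proof of the spine estimate NE7b, which is the cell's OWN estimate, NOT PRINTED
and NOT PROVED).  [folklore] finite ℤᵈ index-model geometry and list combinatorics over parts 1a∕1b∕2a (`splice`,
`dissolve`, `Fresh`, `partV`, `SpliceOK`, `LabelOK`, `CTL`, `chainTouch_splice`, `exists_chainTouch_enum_last`,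
`chainTouch_map_Sop`), row S14's `unionL`∕`ChainTouch`∕`imgC`, brick 2c's `gconn_of_chainTouch` and brick 3a's
`CoverOK`; nothing printed is asserted, no `def … : Prop` fact of Bałaban's (`SplGood` is a displayed SPECIFICATION of
OUR choice), no cite-tagged hypothesis, zero `sorry`.  B16 = [Balaban1989LargeFieldII] p. 386 (the maximal-tree
order) is a manuscript UNDER AUDIT; locators only.

WHAT.  For a `ComponentHistory (Lab d)` with a domain map `dom` that reads a new region's own cubes
(`dom j n = n.2`): **`SplGood`** (for every fresh part `p` continued into `c` at level `j + 1`, `spl j c p` is a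
permutation of `news j p` whose images at level `j + 1` are leaf-first INTO the images listed after `p`);
`dom_eq_unionL_news_of_fresh` (a fresh cluster's domain is the union of its regions, from cover + (G-join));
`imgC_inl_fresh_eq_unionL` (its image one level up is the union of its regions' images, `Sop_unionL`);
**`exists_good_spl`** (choose the LAST region as one whose image touches the later union — it exists because the
cluster's image does —, enumerate the regions leaf-first ending there at the cluster's own level, push the chain
through one `S`-step); the choice **`splOf`** with `splGood_splOf`; and the transports to `H.dissolve spl`:
**`chainTouch_constit_dissolve`** ((G-touch)), **`dom_subset_unionL_dissolve`** ((G-join); a lone continued fresh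
cluster flows onto the union of its regions' images), **`coverOK_dissolve`**.

HONEST.  Proves nothing of Bałaban's; a re-indexing of OUR bookkeeping; by-name class of every `WALL-NE7b-P1.md` §2
binder UNCHANGED; NE7b NOT proved; spine 0∕9.  HONEST DEPENDENCY (cell): continuum YM on T⁴ ⇐ BetaPertH ∧ nine spine
estimates (0/9 proved); BetaPertH ⇐ (D1) ∧ (D4) ∧ CAP+tail; G-an2-4 gates asym, D1 and NE2/3/4.  This file changes none
of it. -/

open Finset
open Literature.MathematicalPhysics.QuantumFieldTheory.Balaban1983to89
open Literature.MathematicalPhysics.QuantumFieldTheory.Balaban1983to89.B13ScaleTransfer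
open Literature.MathematicalPhysics.QuantumFieldTheory.Balaban1983to89.B16SProfile
open Literature.MathematicalPhysics.QuantumFieldTheory.Balaban1983to89.B16MergeGeometry
open Literature.MathematicalPhysics.QuantumFieldTheory.Balaban1983to89.Step.Budget
open Summit.QuantumFields.BalabanUV.T4Continuum.HistoryGenealogyExtraction
open Summit.QuantumFields.BalabanUV.T4Continuum.HistoryGenealogyRealise
open Summit.QuantumFields.BalabanUV.T4Continuum.HistoryGenealogyPedigree

namespace Summit.QuantumFields.BalabanUV.T4Continuum.HistoryGenealogyExtraction

noncomputable section

open Classical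

variable {d : ℕ}

/-! ## §4 The splice order for a component history: specification, existence, choice, transports -/

namespace ComponentHistory

variable (H : ComponentHistory (Lab d)) (dom : ℕ → Lab d → Finset (Pt d)) (L : ℕ) (s : ℕ → ℕ)
  (spl : ℕ → Lab d → Lab d → List (Lab d))

/-- **THE SPECIFICATION OF THE SPLICE ORDER** (displayed; a property of OUR choice): for every fresh part `p`
continued into `c` at level `j + 1`, `spl j c p` enumerates `news j p` without repetition, and its images at level
`j + 1` are leaf-first INTO the images listed after `p` in print's list. [folklore] -/
def SplGood : Prop :=
  ∀ j c p, c ∈ H.comp (j + 1) → p ∈ H.parts (j + 1) c → H.Fresh j p →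
    (spl j c p).Perm (H.news j p) ∧
      ∀ l₁ l₂, H.constit (j + 1) c = l₁ ++ Sum.inl p :: l₂ →
        CTL (l₂.map (imgC L s dom (j + 1))) ((spl j c p).map fun n => imgC L s dom (j + 1) (Sum.inl n))

variable {H dom L s spl}

/-- a good splice order is an admissible one (`SpliceOK`) [folklore] -/
theorem spliceOK_of_splGood (h : H.SplGood dom L s spl) : H.SpliceOK spl :=
  fun j c p hc hp hf => (h j c p hc hp hf).1

/-- **THE DOMAIN OF A FRESH CLUSTER IS THE UNION OF ITS NEW REGIONS** (cover: each region inside; (G-join): the domain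
inside the union of the constituents' images, which are the regions). [folklore] -/
theorem dom_eq_unionL_news_of_fresh (hC : CoverOK H dom L s)
    (hJ : ∀ j c, c ∈ H.comp j → 2 ≤ (H.constit j c).length → dom j c ⊆ unionL ((H.constit j c).map (imgC L s dom j)))
    {j : ℕ} {p : Lab d} (hf : H.Fresh j p) : dom j p = unionL ((H.news j p).map Prod.snd) := by
  have hmap : (H.constit j p).map (imgC L s dom j) = (H.news j p).map Prod.snd := by
    rw [hf.constit_eq, List.map_map]; rfl
  refine Finset.Subset.antisymm (by rw [← hmap]; exact hJ j p hf.mem hf.two_le) fun x hx => ?_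
  obtain ⟨n, hn, hx⟩ := (mem_unionL_map_iff Prod.snd).1 hx
  have := hC j p hf.mem (Sum.inr n) (by rw [hf.constit_eq]; exact List.mem_map.2 ⟨n, hn, rfl⟩)
  exact this (by simpa using hx)

/-- the image one level up of a fresh part is the union of the images of its new regions (when the domain map reads
the regions' own cubes) [folklore] -/
theorem imgC_inl_fresh_eq_unionL (hC : CoverOK H dom L s)
    (hJ : ∀ j c, c ∈ H.comp j → 2 ≤ (H.constit j c).length → dom j c ⊆ unionL ((H.constit j c).map (imgC L s dom j)))
    (hdom : ∀ j (n : Lab d), n ∈ H.newReg j → dom j n = n.2) (hW : H.WF) {j : ℕ} {p : Lab d} (hf : H.Fresh j p)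
    {σ : List (Lab d)} (hσ : σ.Perm (H.news j p)) :
    unionL (σ.map fun n => imgC L s dom (j + 1) (Sum.inl n)) = imgC L s dom (j + 1) (Sum.inl p) := by
  rw [unionL_map_perm _ hσ, imgC_inl, Nat.add_sub_cancel, dom_eq_unionL_news_of_fresh hC hJ hf, Sop_unionL]
  congr 1
  refine List.map_congr_left fun n hn => ?_
  rw [imgC_inl, Nat.add_sub_cancel, hdom j n (hW.news_sub j p hf.mem n hn)]

/-- **A GOOD SPLICE ORDER EXISTS** for every continued fresh part: enumerate the cluster's regions leaf-first at the
cluster's own level, ENDING at a region whose image touches what follows the cluster in print's list one level up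
(such a region exists because the cluster's image — the union of its regions' images — does), and push the chain
through one `S`-step. [folklore] -/
theorem exists_good_spl (hW : H.WF) (hC : CoverOK H dom L s)
    (hT : ∀ j c, c ∈ H.comp j → 2 ≤ (H.constit j c).length → ChainTouch ((H.constit j c).map (imgC L s dom j)))
    (hJ : ∀ j c, c ∈ H.comp j → 2 ≤ (H.constit j c).length → dom j c ⊆ unionL ((H.constit j c).map (imgC L s dom j)))
    (hdom : ∀ j (n : Lab d), n ∈ H.newReg j → dom j n = n.2) (hL : 0 < L) {j : ℕ} {c p : Lab d}
    (hc : c ∈ H.comp (j + 1)) (hp : p ∈ H.parts (j + 1) c) (hf : H.Fresh j p) :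
    ∃ σ : List (Lab d), σ.Perm (H.news j p) ∧ ∀ l₁ l₂, H.constit (j + 1) c = l₁ ++ Sum.inl p :: l₂ →
      CTL (l₂.map (imgC L s dom (j + 1))) (σ.map fun n => imgC L s dom (j + 1) (Sum.inl n)) := by
  -- the split of print's list at `inl p` (unique: the list is duplicate-free)
  obtain ⟨l₁, l₂, hsplit⟩ := List.append_of_mem ((mem_lefts_iff p _).1 hp)
  have hnd : (H.constit (j + 1) c).Nodup := nodup_constit hW (j + 1) c
  -- the cluster's regions have a connected touch graph at their own level
  have hct0 : ChainTouch ((H.news j p).map Prod.snd) := by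
    have := hT j p hf.mem hf.two_le
    rwa [hf.constit_eq, List.map_map] at this
  have hG : GConn (touchGraph (Prod.snd : Lab d → Finset (Pt d))) (H.news j p).toFinset :=
    gconn_of_chainTouch Prod.snd hf.news_ne_nil hct0
  -- the prescribed last region: one whose image touches the later union, if anything comes later
  set f := imgC L s dom (j + 1) with hfdef
  have hq : 0 < ratio L s j := ratio_pos hL s j
  have hlast : ∃ n₀ ∈ H.news j p, l₂ ≠ [] → ∃ a ∈ Sop (ratio L s j) n₀.2, ∃ c' ∈ unionL (l₂.map f), Touch a c' := by
    by_cases hl₂ : l₂ = []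
    · obtain ⟨n, ns, hns⟩ := List.exists_cons_of_ne_nil hf.news_ne_nil
      exact ⟨n, by rw [hns]; exact List.mem_cons_self, fun h => (h hl₂).elim⟩
    · have hctc : ChainTouch ((l₁ ++ Sum.inl p :: l₂).map f) := by
        rw [← hsplit]
        have h2 : 2 ≤ (H.constit (j + 1) c).length := by
          rw [hsplit, List.length_append, List.length_cons]
          have : 1 ≤ l₂.length := List.length_pos_iff.2 hl₂
          omega
        exact hT (j + 1) c hc h2
      obtain ⟨htouch, -⟩ := (ctl_cons _ _ _).1 (ctl_singleton_of_split f l₁ (Sum.inl p) l₂ hctc)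
      obtain ⟨a, ha, c', hc', hac⟩ := htouch (by simpa using hl₂)
      rw [List.nil_append] at hc'
      rw [hfdef, imgC_inl, Nat.add_sub_cancel, dom_eq_unionL_news_of_fresh hC hJ hf, Sop_unionL] at ha
      obtain ⟨n₀, hn₀, ha₀⟩ := (mem_unionL_map_iff _).1 ha
      exact ⟨n₀, hn₀, fun _ => ⟨a, ha₀, c', hc', hac⟩⟩
  obtain ⟨n₀, hn₀, hn₀t⟩ := hlast
  -- leaf-first enumeration of the regions ending at `n₀`, pushed through one `S`-step
  obtain ⟨l, hlnd, hlset, hlct⟩ := exists_chainTouch_enum_last Prod.snd hG (List.mem_toFinset.2 hn₀)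
  have hperm : (l ++ [n₀]).Perm (H.news j p) :=
    List.perm_of_nodup_nodup_toFinset_eq hlnd (hW.news_nodup j p) hlset
  have hct1 : ChainTouch ((l ++ [n₀]).map fun n => Sop (ratio L s j) n.2) := chainTouch_map_Sop hq Prod.snd _ hlct
  have hfeq : ∀ n ∈ l ++ [n₀], f (Sum.inl n) = Sop (ratio L s j) n.2 := fun n hn => by
    rw [hfdef, imgC_inl, Nat.add_sub_cancel, hdom j n (hW.news_sub j p hf.mem n (hperm.mem_iff.1 hn))]
  have hmapeq : (l ++ [n₀]).map (fun n => f (Sum.inl n)) = (l ++ [n₀]).map fun n => Sop (ratio L s j) n.2 :=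
    List.map_congr_left hfeq
  have hct2 : ChainTouch (l.map (fun n => Sop (ratio L s j) n.2) ++ [Sop (ratio L s j) n₀.2]) := by
    rw [← List.map_singleton (f := fun n : Lab d => Sop (ratio L s j) n.2), ← List.map_append]; exact hct1
  refine ⟨l ++ [n₀], hperm, fun l₁' l₂' hsplit' => ?_⟩
  obtain ⟨-, rfl⟩ := append_cons_unique (hsplit.symm.trans hsplit') (hsplit ▸ hnd)
  rw [hmapeq, List.map_append, List.map_singleton]
  refine ctl_append_singleton _ _ _ hct2 fun hl₂ => ?_
  exact hn₀t fun h => hl₂ (by rw [h]; rfl)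

/-- **THE CHOSEN SPLICE ORDER**: a good enumeration when one exists, print's own list of the regions otherwise.
[folklore] -/
def splOf (H : ComponentHistory (Lab d)) (dom : ℕ → Lab d → Finset (Pt d)) (L : ℕ) (s : ℕ → ℕ) (j : ℕ) (c p : Lab d) :
    List (Lab d) :=
  if h : ∃ σ : List (Lab d), σ.Perm (H.news j p) ∧ ∀ l₁ l₂, H.constit (j + 1) c = l₁ ++ Sum.inl p :: l₂ →
      CTL (l₂.map (imgC L s dom (j + 1))) (σ.map fun n => imgC L s dom (j + 1) (Sum.inl n))
  then Classical.choose h else H.news j p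

/-- **THE CHOSEN SPLICE ORDER IS GOOD** (under `WF`, cover, the touch and join clauses, the domain map reading the
regions, `0 < L`). [folklore] -/
theorem splGood_splOf (hW : H.WF) (hC : CoverOK H dom L s)
    (hT : ∀ j c, c ∈ H.comp j → 2 ≤ (H.constit j c).length → ChainTouch ((H.constit j c).map (imgC L s dom j)))
    (hJ : ∀ j c, c ∈ H.comp j → 2 ≤ (H.constit j c).length → dom j c ⊆ unionL ((H.constit j c).map (imgC L s dom j)))
    (hdom : ∀ j (n : Lab d), n ∈ H.newReg j → dom j n = n.2) (hL : 0 < L) : H.SplGood dom L s (splOf H dom L s) := by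
  intro j c p hc hp hf
  have h := exists_good_spl hW hC hT hJ hdom hL hc hp hf
  have : splOf H dom L s j c p = Classical.choose h := by unfold splOf; rw [dif_pos h]
  rw [this]
  exact Classical.choose_spec h

/-! ### transports to the dissolved bookkeeping -/

/-- **(G-touch) SURVIVES THE SPLICE**: every dissolved component with at least two constituents has its constituent
images in leaf-first order (under a good splice order and the label condition). [folklore] -/
theorem chainTouch_constit_dissolve (hW : H.WF) (hL' : H.LabelOK) (hS : H.SplGood dom L s spl) (hC : CoverOK H dom L s)
    (hT : ∀ j c, c ∈ H.comp j → 2 ≤ (H.constit j c).length → ChainTouch ((H.constit j c).map (imgC L s dom j)))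
    (hJ : ∀ j c, c ∈ H.comp j → 2 ≤ (H.constit j c).length → dom j c ⊆ unionL ((H.constit j c).map (imgC L s dom j)))
    (hdom : ∀ j (n : Lab d), n ∈ H.newReg j → dom j n = n.2) {j : ℕ} {x : Lab d}
    (hx : x ∈ (H.dissolve spl).comp j) (h2 : 2 ≤ ((H.dissolve spl).constit j x).length) :
    ChainTouch (((H.dissolve spl).constit j x).map (imgC L s dom j)) := by
  rcases real_or_pseudo hL' hx with ⟨hc, hf, hp⟩ | ⟨hp, -⟩
  · cases j with
    | zero => rw [H.constit_dissolve_zero spl hc hf hp] at h2 ⊢; exact hT 0 x hc h2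
    | succ j =>
        rw [H.constit_dissolve_succ spl hc hf hp] at h2 ⊢
        -- print's list is leaf-first (trivially so when it has one member)
        have hct : ChainTouch ((H.constit (j + 1) x).map (imgC L s dom (j + 1))) := by
          by_cases hlen : 2 ≤ (H.constit (j + 1) x).length
          · exact hT (j + 1) x hc hlen
          · match hl : H.constit (j + 1) x with
            | [] => simp
            | [_] => simp
            | _ :: _ :: _ => rw [hl] at hlen; simp at hlen
        -- replacements: nonempty, union-preserving, leaf-first into their tails — for the parts that occur; extend `partV`
        -- off the parts by the identity replacement so that the list lemma applies unconditionally
        set pV : Lab d → List (Lab d) := fun p => if p ∈ H.parts (j + 1) x then H.partV spl j x p else [p] with hpV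
        have hsame : splice pV (H.constit (j + 1) x) = splice (H.partV spl j x) (H.constit (j + 1) x) := by
          have : ∀ l : List (Lab d ⊕ Lab d), (∀ p, Sum.inl p ∈ l → p ∈ H.parts (j + 1) x) →
              splice pV l = splice (H.partV spl j x) l := by
            intro l
            induction l with
            | nil => intro; rfl
            | cons y l ih =>
                intro hl
                cases y with
                | inl p =>
                    rw [splice_cons_inl, splice_cons_inl, ih fun q hq => hl q (List.mem_cons_of_mem _ hq)]
                    have : pV p = H.partV spl j x p := by rw [hpV]; exact if_pos (hl p List.mem_cons_self)
                    rw [this]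
                | inr n => rw [splice_cons_inr, splice_cons_inr, ih fun q hq => hl q (List.mem_cons_of_mem _ hq)]
          exact this _ fun p hp' => (mem_lefts_iff p _).2 hp'
        rw [← hsame]
        have hne : ∀ p, pV p ≠ [] := fun p => by
          by_cases hpm : p ∈ H.parts (j + 1) x
          · simp only [hpV, hpm, if_true]; exact partV_ne_nil (spliceOK_of_splGood hS) hc hpm
          · simp only [hpV, hpm, if_false]; exact List.cons_ne_nil _ _
        have hU : ∀ p, unionL ((pV p).map fun q => imgC L s dom (j + 1) (Sum.inl q)) = imgC L s dom (j + 1) (Sum.inl p) := by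
          intro p
          by_cases hpm : p ∈ H.parts (j + 1) x
          · simp only [hpV, hpm, if_true]
            by_cases hfp : H.Fresh j p
            · rw [H.partV_of_fresh spl x hfp]
              exact imgC_inl_fresh_eq_unionL hC hJ hdom hW hfp (hS j x p hc hpm hfp).1
            · rw [H.partV_of_not_fresh spl x hfp]; simp
          · simp only [hpV, hpm, if_false]; simp
        refine chainTouch_splice (imgC L s dom (j + 1)) pV hne hU _ hct fun l₁ p l₂ hl => ?_
        have hpm : p ∈ H.parts (j + 1) x := (mem_lefts_iff p _).2 (by rw [hl]; simp)
        simp only [hpV, hpm, if_true]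
        by_cases hfp : H.Fresh j p
        · rw [H.partV_of_fresh spl x hfp]; exact (hS j x p hc hpm hfp).2 l₁ l₂ hl
        · rw [H.partV_of_not_fresh spl x hfp, List.map_singleton]
          exact ctl_singleton_of_split (imgC L s dom (j + 1)) l₁ (Sum.inl p) l₂ (hl ▸ hct)
  · rw [H.constit_dissolve_pseudo spl hp] at h2; simp at h2

/-- **(G-join) SURVIVES THE SPLICE**: the domain of a dissolved component of a successor level with at least two
constituents lies inside the union of its constituents' images (the union is print's; a lone continued fresh cluster
flows by one `S`-operation onto the union of its regions' images). [folklore] -/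
theorem dom_subset_unionL_dissolve (hW : H.WF) (hL' : H.LabelOK) (hS : H.SplGood dom L s spl) (hC : CoverOK H dom L s)
    (hJ : ∀ j c, c ∈ H.comp j → 2 ≤ (H.constit j c).length → dom j c ⊆ unionL ((H.constit j c).map (imgC L s dom j)))
    (hF : ∀ j c p, c ∈ H.comp (j + 1) → H.constit (j + 1) c = [Sum.inl p] → dom (j + 1) c = Sop (ratio L s j) (dom j p))
    (hdom : ∀ j (n : Lab d), n ∈ H.newReg j → dom j n = n.2) {j : ℕ} {x : Lab d}
    (hx : x ∈ (H.dissolve spl).comp j) (h2 : 2 ≤ ((H.dissolve spl).constit j x).length) :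
    dom j x ⊆ unionL (((H.dissolve spl).constit j x).map (imgC L s dom j)) := by
  rcases real_or_pseudo hL' hx with ⟨hc, hf, hp⟩ | ⟨hp, -⟩
  · cases j with
    | zero => rw [H.constit_dissolve_zero spl hc hf hp] at h2 ⊢; exact hJ 0 x hc h2
    | succ j =>
        rw [H.constit_dissolve_succ spl hc hf hp] at h2 ⊢
        -- the union of the spliced images is the union of print's images (parts only are replaced)
        have hUeq : unionL ((splice (H.partV spl j x) (H.constit (j + 1) x)).map (imgC L s dom (j + 1))) =
            unionL ((H.constit (j + 1) x).map (imgC L s dom (j + 1))) := by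
          have : ∀ l : List (Lab d ⊕ Lab d), (∀ p, Sum.inl p ∈ l → p ∈ H.parts (j + 1) x) →
              unionL ((splice (H.partV spl j x) l).map (imgC L s dom (j + 1))) = unionL (l.map (imgC L s dom (j + 1))) := by
            intro l
            induction l with
            | nil => intro; rfl
            | cons y l ih =>
                intro hl
                cases y with
                | inl p =>
                    have hpm := hl p List.mem_cons_self
                    rw [splice_cons_inl, List.map_append, unionL_append, List.map_map, List.map_cons, unionL_cons,
                      ih fun q hq => hl q (List.mem_cons_of_mem _ hq)]
                    congr 1
                    by_cases hfp : H.Fresh j p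
                    · rw [H.partV_of_fresh spl x hfp]
                      exact imgC_inl_fresh_eq_unionL hC hJ hdom hW hfp (hS j x p hc hpm hfp).1
                    · rw [H.partV_of_not_fresh spl x hfp]; simp
                | inr n =>
                    rw [splice_cons_inr, List.map_cons, List.map_cons, unionL_cons, unionL_cons,
                      ih fun q hq => hl q (List.mem_cons_of_mem _ hq)]
          exact this _ fun p hp' => (mem_lefts_iff p _).2 hp'
        rw [hUeq]
        by_cases hlen : 2 ≤ (H.constit (j + 1) x).length
        · exact hJ (j + 1) x hc hlen
        · -- one constituent in print's list: it must be a fresh old part (else the splice keeps the length)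
          match hl : H.constit (j + 1) x with
          | [] => exact absurd hl (hW.nonempty (j + 1) x hc)
          | [Sum.inr n] => rw [hl, splice_singleton_inr] at h2; simp at h2
          | [Sum.inl p] =>
              rw [List.map_singleton, unionL_cons, unionL_nil, Finset.union_empty, hF j x p hc hl]
              exact subset_of_eq (by rw [imgC_inl, Nat.add_sub_cancel])
          | _ :: _ :: _ => rw [hl] at hlen; simp at hlen
  · rw [H.constit_dissolve_pseudo spl hp] at h2; simp at h2

/-- **THE COVER CONDITION SURVIVES THE SPLICE**: every constituent image of a dissolved component lies in the
component's domain (a region standing in for a fresh part has its image inside the part's image). [folklore] -/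
theorem coverOK_dissolve (hW : H.WF) (hL' : H.LabelOK) (hSO : H.SpliceOK spl) (hC : CoverOK H dom L s)
    (hdom : ∀ j (n : Lab d), n ∈ H.newReg j → dom j n = n.2) : CoverOK (H.dissolve spl) dom L s := by
  intro j x hx q hq
  rcases real_or_pseudo hL' hx with ⟨hc, hf, hp⟩ | ⟨hp, -⟩
  · cases j with
    | zero => rw [H.constit_dissolve_zero spl hc hf hp] at hq; exact hC 0 x hc q hq
    | succ j =>
        rw [H.constit_dissolve_succ spl hc hf hp] at hq
        rcases (mem_splice_iff (H.partV spl j x) q _).1 hq with ⟨p, hpl, q', hq', rfl⟩ | ⟨n, rfl, hn⟩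
        · have hpm : p ∈ H.parts (j + 1) x := (mem_lefts_iff p _).2 hpl
          rcases mem_partV_cases hW hSO hc hpm hq' with ⟨hfp, hqn, -⟩ | ⟨-, rfl, -⟩
          · refine Finset.Subset.trans ?_ (hC (j + 1) x hc (Sum.inl p) hpl)
            rw [imgC_inl, imgC_inl, Nat.add_sub_cancel, hdom j q' (hW.news_sub j p hfp.mem q' hqn)]
            refine Sop_mono _ ?_
            have := hC j p hfp.mem (Sum.inr q') (by rw [hfp.constit_eq]; exact List.mem_map.2 ⟨q', hqn, rfl⟩)
            rwa [imgC_inr] at this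
          · exact hC (j + 1) x hc (Sum.inl q') hpl
        · exact hC (j + 1) x hc (Sum.inr n) hn
  · rw [H.constit_dissolve_pseudo spl hp, List.mem_singleton] at hq
    subst hq
    obtain ⟨c, hfc, hn⟩ := H.mem_pseudo_iff.1 hp
    rw [imgC_inr, hdom j x (hW.news_sub j c hfc.mem x hn)]

end ComponentHistory

end

end Summit.QuantumFields.BalabanUV.T4Continuum.HistoryGenealogyExtraction
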